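import Literature.AnabelianGeometry.EtaleTheta.Discharge.Sec3Cor38iOfRatSupport
import Literature.AnabelianGeometry.EtaleTheta.Discharge.Sec3Cor38iiToyGenuine
import Literature.AlgebraicGeometry.Frobenioids.ArchimedeanPointBaseThm36

/-!
# [EtTh] Corollary 3.8 (i) AS TYPED holds OUTRIGHT at the tree's genuine-vocabulary tempered Frobenioid — and so
# does its CONCLUSION "`Ψ` preserves the base-field-theoretic morphisms", for every inhabitant of `Cor38Hyp`

Mochizuki, *The étale theta function and its Frobenioid-theoretic manifestations*, Publ. RIMS **45** (2009),
Cor. 3.8 (i) PDF p. 80, proof p. 81 [cite: MochizukiEtTh2009, Cor 3.8 p.80]; Def. 3.3 (iii) p.73, Prop. 3.4 (ii)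
p.74, Def. 3.6 (i)/(ii) pp. 76–77, Rmk. 3.3.1 p.73.
abc-iut cell, layer L2, cone node `EtTh:Cor3.8(i)` (kernel id `N_EtTh_Cor3_8_i`), seat abc-iut-w6-d039 (gen 3);
PROOF-ONLY (0 definitions) instantiation witness, companion of this lineage's `Discharge/Sec3Cor38iOfRatSupport.lean`
(p438712) — the Cor. 3.8 (i) twin of abc-iut-w6-d040's `Discharge/Sec3Cor38iiToyGenuine.lean` (p437925), whose
toy clauses it consumes BY NAME.  There the node closer over the CONSTRUCTED Def. 3.6 (i) data of monoid type `ℤ`,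
`Cor38Hyp.cor38_i_ofRlfZ_of_structural`, has the hypothesis list (per side)

  `hB₀inj` (pull-backs of `B₀` injective) · `hFSM` (FSM-morphisms of `D` are isomorphisms) · `dm.Prop34` (the typed
  Prop. 3.4 structure) · `hcyc` (Def. 3.6 (ii)(b): divisors of constants are powers of one effective divisor) ·
  `hZQ` (Rmk. 3.3.1) · `hsat` (rational support of `Φ(W)` in `Φ₀(Y_W)^rlf`)

— one clause FEWER than the (ii) closer (`hF₀inv`, needed only for Rmk. 3.6.3) — besides `h : Cor38Hyp C₁ C₂`.
THIS FILE checks every one of them at abc-iut-w5-d164's `Toy.genuineTemperedFrobenioid R S`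
(`TemperedFrobenioidToyGenuine.lean`, p427934: the tempered Frobenioid over `ofRlfZ Toy.divisorMonoids _` with the
GENUINE realification `ℕ^rlf`, the genuine [FrdI] vocabularies `treeMonoidVocab` / `treeCatVocab` and a Frobenioid
certificate), using abc-iut-w6-d040's `Toy.hB₀inj_divisorMonoids` / `Toy.hFSM_discretePUnit`, abc-iut-w4-d008's
`Toy.prop34_divisorMonoids` / `Toy.cnstCyclic_divisorMonoids`, abc-iut-w5-d130's `Toy.isZQMonoprime_primes_Φ₀` /
`Toy.ratSupport_genuine`, and runs the composition END-TO-END: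

* **`Toy.cor38_i_genuine (h : Cor38Hyp C C) : Cor38_i IsFrobeniusSlim h`** for `C := Toy.genuineTemperedFrobenioid
  R S` — [EtTh] Cor. 3.8 (i) AS TYPED (abc-iut-L2-t3's `Cor38_i`, vocabulary parameter := L1's `IsFrobeniusSlim`)
  with NO binder beyond the Cor. 3.8 standing-hypotheses structure `h`, for EVERY such `h` (any self-equivalence
  `Ψ`);
* **`Toy.preservesBaseFieldTheoretic_genuine (h : Cor38Hyp C C) : PreservesBaseFieldTheoretic h`** — the one-object
  base `Discrete PUnit` IS slim (abc-iut-L1's `isSlim_discretePUnit`), hence Frobenius-slim, so the hypothesis of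
  (i) is met and the CONCLUSION of Cor. 3.8 (i) holds outright for every `h`;
* `Toy.exists_cor38_i_genuine`, `Toy.exists_preservesBaseFieldTheoretic_genuine` — with abc-iut-w5-d164's
  inhabitant `Toy.nonempty_cor38Hyp_genuine` (`Ψ := 𝟭`): the node's typed statement and its conclusion have
  UNCONDITIONAL kernel instances (NV census: `Cor38_i` and `PreservesBaseFieldTheoretic` no longer kernel-zero).

HONEST LABEL: a consistency / instantiation witness at DEGENERATE geometry (one object, one prime, `Λ = ℤ`, all
functions constant); it shows that the print-level hypothesis list of the (i) node closer is jointly satisfiable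
together with `Cor38Hyp` over constructed `ofRlfZ` data and that the composition fires, nothing more.  NOT the
tempered Frobenioid of a curve; refereed pre-IUT material; nothing here bears on [IUTchIII] Cor. 3.12; no side
taken; typed ≠ proved.
-/

noncomputable section

namespace Literature.AnabelianGeometry.EtaleTheta

open CategoryTheory Opposite Function Literature.AlgebraicGeometry.Frobenioids

namespace Toy

open Example39NV

variable (R S : ((Discrete PUnit.{1})ᵒᵖ ⥤ CommMonCat.{0}) → Prop)

/-- **[EtTh] Cor. 3.8 (i) AS TYPED holds OUTRIGHT at the genuine toy, for every inhabitant `h` of the Cor. 3.8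
standing hypotheses** (`C₁ = C₂ := Toy.genuineTemperedFrobenioid R S`, any equivalence `Ψ : C ≌ C`): abc-iut-L2-t3's
`Cor38_i` with vocabulary parameter := L1's `IsFrobeniusSlim`, by this lineage's node closer
`Cor38Hyp.cor38_i_ofRlfZ_of_structural` (p438712) — its hypothesis list CHECKED at this datum (`hB₀inj`, `hFSM`,
`Prop34`, `hcyc`, `hZQ`, `hsat` per side) and the composition run end-to-end. [cite: MochizukiEtTh2009, Cor 3.8 p.80] -/
theorem cor38_i_genuine (h : Cor38Hyp (genuineTemperedFrobenioid R S) (genuineTemperedFrobenioid R S)) :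
    Literature.AnabelianGeometry.EtaleTheta.Cor38_i
      (fun E _ => Literature.AlgebraicGeometry.Frobenioids.IsFrobeniusSlim E) h :=
  h.cor38_i_ofRlfZ_of_structural (fun g => hB₀inj_divisorMonoids g) (fun α hα => hFSM_discretePUnit α hα)
    prop34_divisorMonoids cnstCyclic_divisorMonoids (fun _ 𝔭 => isZQMonoprime_primes_Φ₀ _ 𝔭)
    (fun _ => ratSupport_genuine R S _) (fun g => hB₀inj_divisorMonoids g) (fun α hα => hFSM_discretePUnit α hα)
    prop34_divisorMonoids cnstCyclic_divisorMonoids (fun _ 𝔭 => isZQMonoprime_primes_Φ₀ _ 𝔭)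
    (fun _ => ratSupport_genuine R S _)

/-- **The CONCLUSION of [EtTh] Cor. 3.8 (i) — "`Ψ` preserves the base-field-theoretic morphisms" — holds OUTRIGHT
at the genuine toy, for every inhabitant `h` of `Cor38Hyp`**: the one-object base `Discrete PUnit` is slim
(abc-iut-L1's `isSlim_discretePUnit`), hence Frobenius-slim ([FrdI] §0, `IsSlim.isFrobeniusSlim`), which is the
hypothesis of (i). [cite: MochizukiEtTh2009, Cor 3.8 p.80] -/
theorem preservesBaseFieldTheoretic_genuine
    (h : Cor38Hyp (genuineTemperedFrobenioid R S) (genuineTemperedFrobenioid R S)) :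
    Literature.AnabelianGeometry.EtaleTheta.PreservesBaseFieldTheoretic h :=
  cor38_i_genuine R S h isSlim_discretePUnit.isFrobeniusSlim isSlim_discretePUnit.isFrobeniusSlim

/-- **The typed statement of the node `EtTh:Cor3.8(i)` has an unconditional kernel instance**: with abc-iut-w5-d164's
inhabitant of `Cor38Hyp` at the genuine toy (`Ψ := 𝟭`, `Toy.nonempty_cor38Hyp_genuine`).
[cite: MochizukiEtTh2009, Cor 3.8 p.80] -/
theorem exists_cor38_i_genuine :
    ∃ h : Cor38Hyp (genuineTemperedFrobenioid R S) (genuineTemperedFrobenioid R S),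
      Literature.AnabelianGeometry.EtaleTheta.Cor38_i
        (fun E _ => Literature.AlgebraicGeometry.Frobenioids.IsFrobeniusSlim E) h := by
  obtain ⟨h⟩ := nonempty_cor38Hyp_genuine R S
  exact ⟨h, cor38_i_genuine R S h⟩

/-- … and so has its conclusion `PreservesBaseFieldTheoretic`. [cite: MochizukiEtTh2009, Cor 3.8 p.80] -/
theorem exists_preservesBaseFieldTheoretic_genuine :
    ∃ h : Cor38Hyp (genuineTemperedFrobenioid R S) (genuineTemperedFrobenioid R S),
      Literature.AnabelianGeometry.EtaleTheta.PreservesBaseFieldTheoretic h := by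
  obtain ⟨h⟩ := nonempty_cor38Hyp_genuine R S
  exact ⟨h, preservesBaseFieldTheoretic_genuine R S h⟩

end Toy

end Literature.AnabelianGeometry.EtaleTheta

end
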